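import Mathlib.Analysis.InnerProductSpace.Spectrum
import Mathlib.Analysis.InnerProductSpace.PiL2
import HarnessLib

/-!
# A rank-one spike plus a small symmetric perturbation: top eigenvector and power iteration

Topic `Analysis/InnerProduct`. Deterministic linear algebra behind spectral algorithms for planted
structures (Alon–Krivelevich–Sudakov 1998, §2.2; Vershynin 2018, §4.5 "spectral clustering"):
let `T` be a symmetric operator on a finite-dimensional real inner product space such that, for a
unit vector `e` and constants `κ > 0`, `ρ ≥ 0`,

  `⟪T a, b⟫ ≤ κ ⟪e, a⟫ ⟪e, b⟫ + ρ ‖a‖ ‖b‖`  for all `a, b`      (i.e. `T = κ e eᵀ + M`, `‖M‖ ≤ ρ`).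

If `κ ≥ 8ρ` then (`exists_top_eigenvector`) there is a unit eigenvector `u` of `T`, `T u = λ₁ u`,
with `λ₁ ≥ κ - ρ`, `⟪u, e⟫ ≥ 0`, `‖u - e‖ ≤ 4ρ/κ`, and power iteration converges to it from any
start: `‖Tᵗ z - λ₁ᵗ ⟪u, z⟫ u‖ ≤ (2ρ)ᵗ ‖z‖` for all `z` and `t`.

All proofs are elementary (orthonormal eigenbasis `LinearMap.IsSymmetric.eigenvectorBasis`,
Parseval, and the identity `‖λ v - κ⟪e,v⟫ e‖² = λ²(1 - ⟪e,v⟫²) + (λ - κ)² ⟪e,v⟫²` for unit `v`),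
a self-contained substitute for the Davis–Kahan / Courant–Fischer route of the sources.

## References

* N. Alon, M. Krivelevich, B. Sudakov, *Finding a large hidden clique in a random graph*, Random
  Structures Algorithms 13 (1998) 457–466, §2.2 (Prop. 2.1, Prop. 2.3) [AlonKrivelevichSudakov1998].
* R. Vershynin, *High-Dimensional Probability*, CUP 2018, §4.5 (spectral clustering; Davis–Kahan)
  [Vershynin2018].
-/

noncomputable section

open Finset Module
open scoped InnerProductSpace RealInnerProductSpace

namespace Literature.Analysis.InnerProduct

variable {E : Type*} [NormedAddCommGroup E] [InnerProductSpace ℝ E]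

/-! ### The perturbation in operator form -/

/-- From the bilinear bound to the operator bound: `‖T a - κ⟪e,a⟫ e‖ ≤ ρ ‖a‖`. [folklore] -/
theorem norm_sub_spike_le {T : E →ₗ[ℝ] E} {e : E} {κ ρ : ℝ} (hρ : 0 ≤ ρ)
    (hM : ∀ a b : E, ⟪T a, b⟫_ℝ ≤ κ * ⟪e, a⟫_ℝ * ⟪e, b⟫_ℝ + ρ * ‖a‖ * ‖b‖) (a : E) :
    ‖T a - (κ * ⟪e, a⟫_ℝ) • e‖ ≤ ρ * ‖a‖ := by
  set w := T a - (κ * ⟪e, a⟫_ℝ) • e with hw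
  have h := hM a w
  have h1 : ⟪T a, w⟫_ℝ = ‖w‖ ^ 2 + κ * ⟪e, a⟫_ℝ * ⟪e, w⟫_ℝ := by
    have hTa : T a = w + (κ * ⟪e, a⟫_ℝ) • e := by rw [hw, sub_add_cancel]
    rw [hTa, inner_add_left, real_inner_self_eq_norm_sq, real_inner_smul_left]
  have h2 : ‖w‖ * ‖w‖ ≤ ρ * ‖a‖ * ‖w‖ := by nlinarith [h, h1]
  rcases eq_or_ne w 0 with hw0 | hw0
  · rw [hw0, norm_zero]; positivity
  · exact le_of_mul_le_mul_right h2 (norm_pos_iff.2 hw0)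

/-- The Rayleigh quotient at the spike direction is large: `κ - ρ ≤ ⟪T e, e⟫`. [folklore] -/
theorem sub_le_inner_apply_spike {T : E →ₗ[ℝ] E} {e : E} {κ ρ : ℝ} (hρ : 0 ≤ ρ) (he : ‖e‖ = 1)
    (hM : ∀ a b : E, ⟪T a, b⟫_ℝ ≤ κ * ⟪e, a⟫_ℝ * ⟪e, b⟫_ℝ + ρ * ‖a‖ * ‖b‖) :
    κ - ρ ≤ ⟪T e, e⟫_ℝ := by
  have h := norm_sub_spike_le hρ hM e
  rw [real_inner_self_eq_norm_sq, he, one_pow, mul_one, mul_one] at h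
  have hsplit : ⟪T e, e⟫_ℝ = κ + ⟪T e - κ • e, e⟫_ℝ := by
    rw [inner_sub_left, real_inner_smul_left, real_inner_self_eq_norm_sq, he]; ring
  have hcs : |⟪T e - κ • e, e⟫_ℝ| ≤ ‖T e - κ • e‖ * ‖e‖ := abs_real_inner_le_norm _ _
  rw [he, mul_one] at hcs
  have := neg_abs_le ⟪T e - κ • e, e⟫_ℝ
  linarith

/-- The key identity for a unit eigenvector `v` (`T v = λ v`): with `α = ⟪e, v⟫`,
`λ² (1 - α²) + (λ - κ)² α² ≤ ρ²`. [folklore] -/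
theorem eigen_dichotomy_ineq {T : E →ₗ[ℝ] E} {e : E} {κ ρ : ℝ} (hρ : 0 ≤ ρ) (he : ‖e‖ = 1)
    (hM : ∀ a b : E, ⟪T a, b⟫_ℝ ≤ κ * ⟪e, a⟫_ℝ * ⟪e, b⟫_ℝ + ρ * ‖a‖ * ‖b‖)
    {v : E} (hv : ‖v‖ = 1) {lam : ℝ} (hTv : T v = lam • v) :
    lam ^ 2 * (1 - ⟪e, v⟫_ℝ ^ 2) + (lam - κ) ^ 2 * ⟪e, v⟫_ℝ ^ 2 ≤ ρ ^ 2 := by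
  have h := norm_sub_spike_le hρ hM v
  rw [hTv, hv, mul_one] at h
  have hsq : ‖lam • v - (κ * ⟪e, v⟫_ℝ) • e‖ ^ 2 ≤ ρ ^ 2 :=
    pow_le_pow_left₀ (norm_nonneg _) h 2
  have hexp : ‖lam • v - (κ * ⟪e, v⟫_ℝ) • e‖ ^ 2 =
      lam ^ 2 * (1 - ⟪e, v⟫_ℝ ^ 2) + (lam - κ) ^ 2 * ⟪e, v⟫_ℝ ^ 2 := by
    rw [norm_sub_sq_real, norm_smul, norm_smul, hv, he, real_inner_smul_left,
      real_inner_smul_right, real_inner_comm e v, Real.norm_eq_abs, Real.norm_eq_abs, mul_one,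
      mul_one, sq_abs, sq_abs]
    ring
  rw [hexp] at hsq
  exact hsq

/-! ### The top eigenvector and power iteration -/

/-- Distance of a nonnegatively-oriented unit eigenvector with large eigenvalue from the spike
direction: `‖u - e‖ ≤ 4ρ/κ` when `T u = λ₁ u`, `κ ≤ 2 λ₁`. [folklore] -/
theorem norm_eigenvector_sub_spike_le {T : E →ₗ[ℝ] E} {e : E} {κ ρ : ℝ} (hρ : 0 ≤ ρ)
    (he : ‖e‖ = 1) (hκ0 : 0 < κ)
    (hM : ∀ a b : E, ⟪T a, b⟫_ℝ ≤ κ * ⟪e, a⟫_ℝ * ⟪e, b⟫_ℝ + ρ * ‖a‖ * ‖b‖)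
    {u : E} (hunorm : ‖u‖ = 1) {lam₁ : ℝ} (hTu : T u = lam₁ • u) (hue0 : 0 ≤ ⟪u, e⟫_ℝ)
    (hlam : κ ≤ 2 * lam₁) : ‖u - e‖ ≤ 4 * ρ / κ := by
  have hlam₀pos : 0 < lam₁ := by linarith
  obtain ⟨a₀, ha₀⟩ : ∃ a₀ : ℝ, a₀ = ⟪e, u⟫_ℝ := ⟨_, rfl⟩
  obtain ⟨w, hw⟩ : ∃ w : E, w = u - a₀ • e := ⟨_, rfl⟩
  have hwe : ⟪w, e⟫_ℝ = 0 := by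
    rw [hw, inner_sub_left, real_inner_smul_left, real_inner_self_eq_norm_sq, he, ha₀,
      real_inner_comm]
    ring
  have ha₀1 : a₀ ≤ 1 := by
    have := real_inner_le_norm e u
    rw [he, hunorm, one_mul] at this
    rwa [ha₀]
  have ha₀0 : 0 ≤ a₀ := by rw [ha₀, real_inner_comm]; exact hue0
  -- Pythagoras for `u = w + a₀ e`
  have hu' : u = w + a₀ • e := by rw [hw, sub_add_cancel]
  have hpy : ‖w‖ ^ 2 + a₀ ^ 2 = 1 := by
    have h := congrArg (fun x => ‖x‖ ^ 2) hu'
    simp only [hunorm, one_pow] at h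
    rw [norm_add_sq_real, real_inner_smul_right, hwe, norm_smul, he, Real.norm_eq_abs,
      mul_one, mul_zero, sq_abs] at h
    linarith
  -- `λ₁ ‖w‖ ≤ ρ` from the operator bound and Pythagoras
  have hop := norm_sub_spike_le hρ hM u
  rw [hTu, hunorm, mul_one, ← ha₀] at hop
  have hdecomp : lam₁ • u - (κ * a₀) • e = lam₁ • w + (lam₁ * a₀ - κ * a₀) • e := by
    rw [hu']
    module
  have hpy2 : ‖lam₁ • w + (lam₁ * a₀ - κ * a₀) • e‖ ^ 2 =
      lam₁ ^ 2 * ‖w‖ ^ 2 + (lam₁ * a₀ - κ * a₀) ^ 2 := by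
    rw [norm_add_sq_real, norm_smul, norm_smul, he, real_inner_smul_left, real_inner_smul_right,
      hwe, Real.norm_eq_abs, Real.norm_eq_abs, mul_one, mul_pow, sq_abs, sq_abs]
    ring
  have hw1 : lam₁ ^ 2 * ‖w‖ ^ 2 ≤ ρ ^ 2 := by
    have h := pow_le_pow_left₀ (norm_nonneg _) hop 2
    rw [hdecomp, hpy2] at h
    nlinarith [sq_nonneg (lam₁ * a₀ - κ * a₀)]
  have hw2 : lam₁ * ‖w‖ ≤ ρ := by
    have h0 : 0 ≤ lam₁ * ‖w‖ := mul_nonneg hlam₀pos.le (norm_nonneg _)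
    have h1 : (lam₁ * ‖w‖) ^ 2 ≤ ρ ^ 2 := by rw [mul_pow]; exact hw1
    exact (pow_le_pow_iff_left₀ h0 hρ two_ne_zero).1 h1
  -- `‖u - e‖ ≤ ‖w‖ + (1 - a₀) ≤ 2 ‖w‖`
  have h1a : 1 - a₀ ≤ ‖w‖ ^ 2 := by nlinarith
  have hwsq : ‖w‖ ^ 2 ≤ ‖w‖ := by
    have hwle1 : ‖w‖ ≤ 1 := by nlinarith [norm_nonneg w, sq_nonneg a₀]
    nlinarith [norm_nonneg w]
  have hue_le : ‖u - e‖ ≤ 2 * ‖w‖ := by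
    have h1 : u - e = w - (1 - a₀) • e := by rw [hu']; module
    have h2 : ‖(1 - a₀) • e‖ = 1 - a₀ := by
      rw [norm_smul, he, mul_one, Real.norm_eq_abs, abs_of_nonneg (by linarith)]
    calc ‖u - e‖ = ‖w - (1 - a₀) • e‖ := by rw [h1]
      _ ≤ ‖w‖ + ‖(1 - a₀) • e‖ := norm_sub_le _ _
      _ = ‖w‖ + (1 - a₀) := by rw [h2]
      _ ≤ ‖w‖ + ‖w‖ := by linarith
      _ = 2 * ‖w‖ := by ring
  -- `2 ‖w‖ ≤ 2ρ/λ₁ ≤ 4ρ/κ`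
  have hfin : 2 * ‖w‖ * κ ≤ 4 * ρ := by
    calc 2 * ‖w‖ * κ ≤ 2 * ‖w‖ * (2 * lam₁) := by gcongr
      _ = 4 * (lam₁ * ‖w‖) := by ring
      _ ≤ 4 * ρ := by linarith
  rw [le_div_iff₀ hκ0]
  exact le_trans (mul_le_mul_of_nonneg_right hue_le hκ0.le) hfin

/-- **Power iteration** in an orthonormal eigenbasis: if all eigenvalues except `λ_{i₀}` have
square `≤ 2ρ²`, then `‖Tᵗ z - λ_{i₀}ᵗ ⟪u, z⟫ u‖ ≤ (2ρ)ᵗ ‖z‖` for `u = ± b i₀`. [folklore] -/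
theorem power_iteration_bound {ι : Type*} [Fintype ι] [DecidableEq ι]
    {T : E →ₗ[ℝ] E} (b : OrthonormalBasis ι ℝ E) (lam : ι → ℝ)
    (hTb : ∀ i, T (b i) = lam i • b i) {ρ : ℝ} (hρ : 0 ≤ ρ) {i₀ : ι}
    (hothers : ∀ i, i ≠ i₀ → lam i ^ 2 ≤ 2 * ρ ^ 2) {σ : ℝ} (hσsq : σ * σ = 1) {u : E}
    (hu : u = σ • b i₀) (z : E) (t : ℕ) :
    ‖(T ^ t) z - (lam i₀ ^ t * ⟪u, z⟫_ℝ) • u‖ ≤ (2 * ρ) ^ t * ‖z‖ := by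
  have hpow : ∀ (t : ℕ) (i : ι), (T ^ t) (b i) = lam i ^ t • b i := by
    intro t i
    induction t with
    | zero => simp
    | succ t ih => rw [pow_succ', Module.End.mul_apply, ih, map_smul, hTb, smul_smul, ← pow_succ]
  -- expand `z` in the eigenbasis
  obtain ⟨c, hc⟩ : ∃ c : ι → ℝ, ∀ i, c i = ⟪b i, z⟫_ℝ := ⟨_, fun i => rfl⟩
  have hz : z = ∑ i, c i • b i := by
    conv_lhs => rw [← b.sum_repr' z]
    exact sum_congr rfl fun i _ => by rw [hc i]
  have hTz : (T ^ t) z = ∑ i, (c i * lam i ^ t) • b i := by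
    conv_lhs => rw [hz]
    rw [map_sum]
    exact sum_congr rfl fun i _ => by rw [map_smul, hpow, smul_smul]
  have huz : (lam i₀ ^ t * ⟪u, z⟫_ℝ) • u = (c i₀ * lam i₀ ^ t) • b i₀ := by
    rw [hu, real_inner_smul_left, smul_smul, ← hc]
    congr 1
    calc lam i₀ ^ t * (σ * c i₀) * σ = (σ * σ) * (c i₀ * lam i₀ ^ t) := by ring
      _ = c i₀ * lam i₀ ^ t := by rw [hσsq, one_mul]
  obtain ⟨d, hd⟩ : ∃ d : ι → ℝ, ∀ i, d i = if i = i₀ then 0 else c i * lam i ^ t :=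
    ⟨_, fun i => rfl⟩
  have hdiff : (T ^ t) z - (lam i₀ ^ t * ⟪u, z⟫_ℝ) • u = ∑ i, d i • b i := by
    rw [hTz, huz, ← Finset.sum_erase_add _ _ (mem_univ i₀), add_sub_cancel_right,
      ← Finset.sum_erase_add (univ : Finset ι) (fun i => d i • b i) (mem_univ i₀)]
    simp only [hd, if_true, zero_smul, add_zero]
    exact sum_congr rfl fun i hi => by rw [if_neg (mem_erase.1 hi).1]
  -- norm of an orthonormal combination
  have hnormd : ‖∑ i, d i • b i‖ ^ 2 = ∑ i, d i ^ 2 := by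
    rw [← b.sum_sq_inner_right]
    exact sum_congr rfl fun i _ => by rw [b.orthonormal.inner_right_fintype]
  have hdsq : ∑ i, d i ^ 2 ≤ (2 * ρ ^ 2) ^ t * ‖z‖ ^ 2 := by
    have hz2 : ‖z‖ ^ 2 = ∑ i, c i ^ 2 := by
      rw [← b.sum_sq_inner_right z]
      exact sum_congr rfl fun i _ => by rw [hc i]
    rw [hz2, mul_sum]
    refine sum_le_sum fun i _ => ?_
    by_cases hi : i = i₀
    · rw [hd i, if_pos hi, zero_pow two_ne_zero]; positivity
    · rw [hd i, if_neg hi, mul_pow, pow_right_comm]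
      calc c i ^ 2 * (lam i ^ 2) ^ t ≤ c i ^ 2 * (2 * ρ ^ 2) ^ t := by
            gcongr
            exact hothers i hi
        _ = (2 * ρ ^ 2) ^ t * c i ^ 2 := mul_comm _ _
  rw [hdiff]
  have h22 : (2 * ρ ^ 2) ^ t ≤ ((2 * ρ) ^ 2) ^ t :=
    pow_le_pow_left₀ (by positivity) (by nlinarith [sq_nonneg ρ]) t
  have hfinal : ‖∑ i, d i • b i‖ ^ 2 ≤ ((2 * ρ) ^ t * ‖z‖) ^ 2 := by
    rw [hnormd]
    refine hdsq.trans ?_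
    calc (2 * ρ ^ 2) ^ t * ‖z‖ ^ 2 ≤ ((2 * ρ) ^ 2) ^ t * ‖z‖ ^ 2 :=
          mul_le_mul_of_nonneg_right h22 (sq_nonneg _)
      _ = ((2 * ρ) ^ t * ‖z‖) ^ 2 := by
          rw [mul_pow ((2 * ρ) ^ t) ‖z‖ 2, ← pow_mul, ← pow_mul, mul_comm 2 t]
  exact (pow_le_pow_iff_left₀ (norm_nonneg _) (by positivity) two_ne_zero).1 hfinal

/-- The analysis in an orthonormal eigenbasis `b` of `T` (`T (b i) = λᵢ b i`): the conclusions of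
`exists_top_eigenvector`. [folklore] -/
theorem exists_top_eigenvector_of_basis {ι : Type*} [Fintype ι] [DecidableEq ι]
    {T : E →ₗ[ℝ] E} (b : OrthonormalBasis ι ℝ E) (lam : ι → ℝ)
    (hTb : ∀ i, T (b i) = lam i • b i)
    {e : E} (he : ‖e‖ = 1) {κ ρ : ℝ} (hρ : 0 ≤ ρ) (hκ0 : 0 < κ) (hκ : 8 * ρ ≤ κ)
    (hM : ∀ a b : E, ⟪T a, b⟫_ℝ ≤ κ * ⟪e, a⟫_ℝ * ⟪e, b⟫_ℝ + ρ * ‖a‖ * ‖b‖) :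
    ∃ u : E, ∃ lam₁ : ℝ, ‖u‖ = 1 ∧ T u = lam₁ • u ∧ κ - ρ ≤ lam₁ ∧ 0 ≤ ⟪u, e⟫_ℝ ∧
      ‖u - e‖ ≤ 4 * ρ / κ ∧
      ∀ (z : E) (t : ℕ), ‖(T ^ t) z - (lam₁ ^ t * ⟪u, z⟫_ℝ) • u‖ ≤ (2 * ρ) ^ t * ‖z‖ := by
  have hbnorm : ∀ i, ‖b i‖ = 1 := fun i => b.orthonormal.1 i
  -- coefficients of `e`
  obtain ⟨α, hα⟩ : ∃ α : ι → ℝ, ∀ i, α i = ⟪b i, e⟫_ℝ := ⟨_, fun i => rfl⟩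
  have hα' : ∀ i, ⟪e, b i⟫_ℝ = α i := fun i => by rw [hα i, real_inner_comm]
  have hαsum : ∑ i, α i ^ 2 = 1 := by
    have h := b.sum_sq_inner_right e
    rw [he, one_pow] at h
    rw [← h]
    exact sum_congr rfl fun i _ => by rw [hα i]
  -- the dichotomy for each eigenvector
  have hdich : ∀ i, lam i ^ 2 * (1 - α i ^ 2) + (lam i - κ) ^ 2 * α i ^ 2 ≤ ρ ^ 2 := by
    intro i
    have h := eigen_dichotomy_ineq hρ he hM (hbnorm i) (hTb i)
    rwa [hα' i] at h
  have hsmall : ∀ i, α i ^ 2 ≤ 1 / 2 → lam i ^ 2 ≤ 2 * ρ ^ 2 := by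
    intro i hi
    have h := hdich i
    nlinarith [sq_nonneg (lam i), sq_nonneg (lam i - κ), sq_nonneg (α i)]
  -- the Rayleigh quotient at `e` singles out a large eigenvalue
  have hTe : T e = ∑ i, (α i * lam i) • b i := by
    calc T e = T (∑ i, ⟪b i, e⟫_ℝ • b i) := by rw [b.sum_repr']
      _ = ∑ i, (α i * lam i) • b i := by
          rw [map_sum]
          exact sum_congr rfl fun i _ => by rw [map_smul, hTb, smul_smul, ← hα i]
  have hRay : ⟪T e, e⟫_ℝ = ∑ i, lam i * α i ^ 2 := by
    rw [hTe, sum_inner]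
    refine sum_congr rfl fun i _ => ?_
    rw [real_inner_smul_left, ← hα i]
    ring
  obtain ⟨i₀, hi₀⟩ : ∃ i₀, κ - ρ ≤ lam i₀ := by
    by_contra hcon
    push Not at hcon
    have hlt : ∑ i, lam i * α i ^ 2 < ∑ i, (κ - ρ) * α i ^ 2 := by
      obtain ⟨j, hj⟩ : ∃ j, 0 < α j ^ 2 := by
        by_contra hnone
        push Not at hnone
        have : ∑ i, α i ^ 2 ≤ 0 := sum_nonpos fun i _ => hnone i
        linarith
      exact sum_lt_sum (fun i _ => mul_le_mul_of_nonneg_right (hcon i).le (sq_nonneg _))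
        ⟨j, mem_univ _, mul_lt_mul_of_pos_right (hcon j) hj⟩
    rw [← mul_sum, hαsum, mul_one, ← hRay] at hlt
    linarith [sub_le_inner_apply_spike hρ he hM]
  -- hence `α i₀² > 1/2` and all other eigenvalues are small
  have hα₀ : 1 / 2 < α i₀ ^ 2 := by
    by_contra hle
    have h := hsmall i₀ (not_lt.1 hle)
    nlinarith
  have hothers : ∀ i, i ≠ i₀ → lam i ^ 2 ≤ 2 * ρ ^ 2 := by
    intro i hi
    refine hsmall i ?_
    by_contra hgt
    push Not at hgt
    have hsum2 : ∑ j ∈ ({i₀, i} : Finset ι), α j ^ 2 ≤ ∑ j, α j ^ 2 :=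
      sum_le_sum_of_subset_of_nonneg (subset_univ _) fun j _ _ => sq_nonneg _
    rw [sum_pair (Ne.symm hi)] at hsum2
    linarith
  -- the signed top eigenvector
  obtain ⟨σ, hσsq, hσα⟩ : ∃ σ : ℝ, σ * σ = 1 ∧ σ * α i₀ = |α i₀| := by
    rcases le_or_gt 0 (α i₀) with h | h
    · exact ⟨1, by norm_num, by rw [one_mul, abs_of_nonneg h]⟩
    · exact ⟨-1, by norm_num, by rw [abs_of_neg h]; ring⟩
  have hσabs : |σ| = 1 := by
    have : |σ| * |σ| = 1 := by rw [← abs_mul, hσsq, abs_one]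
    nlinarith [abs_nonneg σ]
  obtain ⟨u, hu⟩ : ∃ u : E, u = σ • b i₀ := ⟨_, rfl⟩
  have hunorm : ‖u‖ = 1 := by rw [hu, norm_smul, Real.norm_eq_abs, hσabs, hbnorm, one_mul]
  have hTu : T u = lam i₀ • u := by rw [hu, map_smul, hTb, smul_comm]
  have hue : ⟪u, e⟫_ℝ = |α i₀| := by
    rw [hu, real_inner_smul_left, ← hα i₀, hσα]
  have hue0 : 0 ≤ ⟪u, e⟫_ℝ := by rw [hue]; exact abs_nonneg _
  have hdist : ‖u - e‖ ≤ 4 * ρ / κ :=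
    norm_eigenvector_sub_spike_le hρ he hκ0 hM hunorm hTu hue0 (by linarith)
  exact ⟨u, lam i₀, hunorm, hTu, hi₀, hue0, hdist,
    fun z t => power_iteration_bound b lam hTb hρ hothers hσsq hu z t⟩

/-- **Rank-one spike plus perturbation.** Let `T` be a symmetric operator on a finite-dimensional
real inner product space with `⟪T a, b⟫ ≤ κ ⟪e,a⟫⟪e,b⟫ + ρ ‖a‖ ‖b‖` for a unit vector `e` and
`0 ≤ 8ρ ≤ κ`, `0 < κ`. Then `T` has a unit eigenvector `u`, `T u = λ₁ u`, with `λ₁ ≥ κ - ρ`,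
`⟪u, e⟫ ≥ 0`, `‖u - e‖ ≤ 4ρ/κ`, and for every start vector `z` and every `t`,
`‖Tᵗ z - λ₁ᵗ ⟪u, z⟫ u‖ ≤ (2ρ)ᵗ ‖z‖` (power iteration). [AKS 1998, §2.2 (Prop. 2.1, 2.3, Cor. 2.5,
for the second eigenvector of the adjacency matrix); here for the centred matrix.] [folklore] -/
theorem exists_top_eigenvector [FiniteDimensional ℝ E] {T : E →ₗ[ℝ] E} (hT : T.IsSymmetric)
    {e : E} (he : ‖e‖ = 1) {κ ρ : ℝ} (hρ : 0 ≤ ρ) (hκ0 : 0 < κ) (hκ : 8 * ρ ≤ κ)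
    (hM : ∀ a b : E, ⟪T a, b⟫_ℝ ≤ κ * ⟪e, a⟫_ℝ * ⟪e, b⟫_ℝ + ρ * ‖a‖ * ‖b‖) :
    ∃ u : E, ∃ lam₁ : ℝ, ‖u‖ = 1 ∧ T u = lam₁ • u ∧ κ - ρ ≤ lam₁ ∧ 0 ≤ ⟪u, e⟫_ℝ ∧
      ‖u - e‖ ≤ 4 * ρ / κ ∧
      ∀ (z : E) (t : ℕ), ‖(T ^ t) z - (lam₁ ^ t * ⟪u, z⟫_ℝ) • u‖ ≤ (2 * ρ) ^ t * ‖z‖ := by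
  have hTb : ∀ i, T (hT.eigenvectorBasis rfl i) =
      hT.eigenvalues rfl i • hT.eigenvectorBasis rfl i := fun i =>
    hT.apply_eigenvectorBasis rfl i
  exact exists_top_eigenvector_of_basis (hT.eigenvectorBasis rfl) (hT.eigenvalues rfl) hTb he hρ
    hκ0 hκ hM

end Literature.Analysis.InnerProduct

end
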